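import Summits.QuantumAdvantage.AdviceFreeQNC0.RingLocalPolylog
import HarnessLib

/-!
# Cell qa-qnc0 (p = 3 line, crux `RingDenseResidualLt3`): LOCAL + COMMON POLYLOG JUNTA ring strategies lose
# (class (L) of planner qa-qnc0-p1 g19's case map, ROUND-18 §3.8, at polylog parameters)

`ringLocalJunta_polylog_lt3`: there is ONE `θ < 1` such that for every `C`, all large `N`, every radius
`w ≤ (log₂ N)^C`, every junta `J` of at most `(log₂ N)^C` positions and every ring strategy `f` whose output bit
`k` reads only the pattern bits at cyclic distance `≤ w` from `k` TOGETHER WITH the bits in `J` (arbitrary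
dependence), `f` satisfies the ring relation on at most `θ·2^{N-1}` odd patterns.

Same engine as `RingLocalPolylog.lean` (transport to walk coordinates, junta degree, the cross-free window
theorem `ringWinU_crossFree_le`), plus a PIGEONHOLE for the window position: the `≤ 2|J|` walk bits read through
the junta spoil at most `2|J|` of `2|J| + 1` disjoint candidate windows, so some window in the middle of the
cycle reads the junta from OUTSIDE and is cross-free.

WHAT THIS IS NOT: not the planner's sharp/linear-radius `RingLocalLt3`; nothing on strategies reading far bits
through anything but a common junta; crux 22907 untouched; separation NOT moved.
-/

noncomputable section

namespace Summit.QuantumAdvantage.AdviceFreeQNC0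

open Finset Literature.Computability.QuantumComplexity Literature.Computability.MetaComplexity
open Literature.Computability.MetaComplexity.Smolensky

namespace RingLocalPolylog

variable {n : ℕ}

/-- The walk bits read through the junta `J`: `u_i` with `i = j` or `i + 1 = j` for some `j ∈ J`. -/
def jreads (J : Finset (Fin (n + 1))) : Finset (Fin n) :=
  univ.filter fun i : Fin n => ∃ j ∈ J, i.val = j.val ∨ i.val + 1 = j.val

/-- At most `2|J|` walk bits are read through the junta. -/
theorem card_jreads_le (J : Finset (Fin (n + 1))) : (jreads J).card ≤ 2 * J.card := by
  have hsub : jreads J ⊆ J.biUnion fun j => univ.filter fun i : Fin n => i.val = j.val ∨ i.val + 1 = j.val := by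
    intro i hi
    unfold jreads at hi
    rw [mem_filter] at hi
    obtain ⟨j, hj, hij⟩ := hi.2
    rw [mem_biUnion]
    exact ⟨j, hj, mem_filter.2 ⟨mem_univ _, hij⟩⟩
  refine (card_le_card hsub).trans (card_biUnion_le.trans ?_)
  have hfib : ∀ j : Fin (n + 1), (univ.filter fun i : Fin n => i.val = j.val ∨ i.val + 1 = j.val).card ≤ 2 := by
    intro j
    calc _ ≤ ({j.val, j.val - 1} : Finset ℕ).card := by
          refine card_le_card_of_injOn Fin.val (fun i hi => ?_) (fun i _ i' _ h => Fin.ext h)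
          rw [mem_coe, mem_filter] at hi
          rw [mem_coe, mem_insert, mem_singleton]; omega
      _ ≤ 2 := card_le_two
  calc ∑ j ∈ J, (univ.filter fun i : Fin n => i.val = j.val ∨ i.val + 1 = j.val).card
      ≤ ∑ j ∈ J, 2 := sum_le_sum fun j _ => hfib j
    _ = 2 * J.card := by rw [sum_const, smul_eq_mul, mul_comm]

/-- The transported selector of a (radius-`w` + junta `J`)-local ring strategy depends only on
`reads w g ∪ jreads J`. -/
theorem transported_congr_junta (w : ℕ) (J : Finset (Fin (n + 1))) (f : (Fin (n + 1) → Bool) → (Fin (n + 1) → Bool))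
    (hf : ∀ x x' : Fin (n + 1) → Bool, ∀ k : Fin (n + 1),
      (∀ j : Fin (n + 1), (((j.val + (n + 1) - k.val) % (n + 1) ≤ w ∨ (k.val + (n + 1) - j.val) % (n + 1) ≤ w) ∨
        j ∈ J) → x j = x' j) → f x k = f x' k)
    (g : Fin (n + 1)) (u v : Fin n → Bool) (huv : ∀ i ∈ reads w g ∪ jreads J, u i = v i) :
    xor (f (xOfU u) g) (tGuess (xOfU u) g) = xor (f (xOfU v) g) (tGuess (xOfU v) g) := by
  have hx : ∀ j : Fin (n + 1), Near w g j → xOfU u j = xOfU v j := by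
    intro j hj
    refine xOfU_congr u v j fun i hi => huv i (mem_union_left _ ?_)
    unfold reads
    exact mem_filter.2 ⟨mem_univ _, j, hj, hi⟩
  have hxJ : ∀ j ∈ J, xOfU u j = xOfU v j := by
    intro j hj
    refine xOfU_congr u v j fun i hi => huv i (mem_union_right _ ?_)
    unfold jreads
    exact mem_filter.2 ⟨mem_univ _, j, hj, hi⟩
  have h1 : f (xOfU u) g = f (xOfU v) g := hf _ _ g fun j hj => by
    rcases hj with hj | hj
    · exact hx j (Or.inl hj)
    · exact hxJ j hj
  have h2 : tGuess (xOfU u) g = tGuess (xOfU v) g := by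
    unfold tGuess
    rw [hx g (Or.inr (Or.inl rfl)), hx (RingHLF.nxt g) (Or.inr (Or.inr rfl))]
  rw [h1, h2]

/-- **Pigeonhole for the window position.** Among `T` disjoint candidate slots `[a + tS, a + tS + S)`,
`t < T`, with `T` exceeding the number of marked points, some slot contains no marked point. -/
theorem exists_free_slot (M : Finset (Fin n)) (a S T : ℕ) (hS : 0 < S) (hT : M.card < T) :
    ∃ t, t < T ∧ ∀ i ∈ M, ¬ (a + t * S ≤ i.val ∧ i.val < a + t * S + S) := by
  have hex : ∃ t ∈ range T, t ∉ M.image fun i : Fin n => (i.val - a) / S := by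
    by_contra hall
    push Not at hall
    have hsub : range T ⊆ M.image fun i : Fin n => (i.val - a) / S := fun t ht => hall t ht
    have h1 := card_le_card hsub
    rw [card_range] at h1
    have h2 := card_image_le (s := M) (f := fun i : Fin n => (i.val - a) / S)
    omega
  obtain ⟨t, ht, hnot⟩ := hex
  refine ⟨t, mem_range.1 ht, fun i hi hin => hnot ?_⟩
  rw [mem_image]
  refine ⟨i, hi, ?_⟩
  have hlo : t * S ≤ i.val - a := by omega
  have hhi : i.val - a < (t + 1) * S := by rw [add_mul, one_mul]; omega
  have h1 : t ≤ (i.val - a) / S := (Nat.le_div_iff_mul_le hS).2 hlo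
  have h2 : (i.val - a) / S < t + 1 := (Nat.div_lt_iff_lt_mul hS).2 hhi
  omega

end RingLocalPolylog

open RingLocalPolylog

/-- **R-loc + common junta at polylog parameters (p = 3 line; field-free).**  There is `θ < 1` such that for
every `C`, all large `N`, every radius `w ≤ (log₂ N)^C`, every junta `J` with `|J| ≤ (log₂ N)^C` and every ring
strategy `f` whose output bit `k` reads only the pattern bits at cyclic distance `≤ w` from `k` and the bits in
`J` (arbitrary dependence), `f` satisfies the ring relation on at most `θ·2^{N-1}` odd patterns. -/
theorem ringLocalJunta_polylog_lt3 :
    ∃ θ : ℝ, θ < 1 ∧ ∀ C : ℕ, ∃ N₀ : ℕ, ∀ N ≥ N₀, ∀ w : ℕ, w ≤ (Nat.log 2 N) ^ C →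
      ∀ J : Finset (Fin N), J.card ≤ (Nat.log 2 N) ^ C →
      ∀ f : (Fin N → Bool) → (Fin N → Bool),
        (∀ x x' : Fin N → Bool, ∀ k : Fin N,
          (∀ j : Fin N, (((j.val + N - k.val) % N ≤ w ∨ (k.val + N - j.val) % N ≤ w) ∨ j ∈ J) → x j = x' j) →
            f x k = f x' k) →
        haveI : DecidablePred (fun x : Fin N → Bool => OddZeros x ∧ RingHLF.Rel x (f x)) :=
          fun _ => Classical.propDecidable _
        ((univ.filter fun x : Fin N → Bool => OddZeros x ∧ RingHLF.Rel x (f x)).card : ℝ) ≤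
          θ * (2 : ℝ) ^ (N - 1) := by
  obtain ⟨θ, hθ, H⟩ := ringWinU_crossFree_le
  refine ⟨θ, hθ, fun C => ?_⟩
  set K := 2 * C + 4 with hK
  obtain ⟨n₁, hn₁⟩ := H K
  obtain ⟨n₂, hn₂⟩ := TubePlanProof.logPow_le_natSqrt (2 * K + 2 * C + 3)
  refine ⟨max (n₁ + 1) (max (n₂ + 1) 257), fun N hN w hw J hJ f hf => ?_⟩
  obtain ⟨n, rfl⟩ : ∃ n, N = n + 1 := ⟨N - 1, by have := le_max_left (n₁ + 1) (max (n₂ + 1) 257); omega⟩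
  have hn₁n : n₁ ≤ n := by have := le_max_left (n₁ + 1) (max (n₂ + 1) 257); omega
  have hn₂n : n₂ ≤ n := by
    have := le_trans (le_max_left _ _) (le_max_right (n₁ + 1) (max (n₂ + 1) 257)); omega
  have hn256 : 256 ≤ n := by
    have := le_trans (le_max_right _ _) (le_max_right (n₁ + 1) (max (n₂ + 1) 257)); omega
  have hlog8 : 8 ≤ Nat.log 2 n := Nat.le_log_of_pow_le (by norm_num) hn256
  -- polylog in `N = n + 1` versus polylog in `n`
  have hlogN : Nat.log 2 (n + 1) ≤ 2 * Nat.log 2 n := by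
    calc Nat.log 2 (n + 1) ≤ Nat.log 2 (n * 2) := Nat.log_mono_right (by omega)
      _ = Nat.log 2 n + 1 := Nat.log_mul_base (by norm_num) (by omega)
      _ ≤ 2 * Nat.log 2 n := by omega
  set X := (Nat.log 2 n) ^ (2 * C) with hX
  have hpoly : ∀ m : ℕ, m ≤ (Nat.log 2 (n + 1)) ^ C → m ≤ X := by
    intro m hm
    calc m ≤ (Nat.log 2 (n + 1)) ^ C := hm
      _ ≤ (2 * Nat.log 2 n) ^ C := Nat.pow_le_pow_left hlogN C
      _ = 2 ^ C * (Nat.log 2 n) ^ C := by rw [mul_pow]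
      _ ≤ (Nat.log 2 n) ^ C * (Nat.log 2 n) ^ C :=
          Nat.mul_le_mul_right _ (Nat.pow_le_pow_left (by omega) C)
      _ = X := by rw [hX, ← pow_add, two_mul]
  have hw' : w ≤ X := hpoly w (by simpa using hw)
  have hJ' : J.card ≤ X := hpoly J.card (by simpa using hJ)
  have hX1 : 1 ≤ X := Nat.one_le_pow _ _ (by omega)
  -- the junta size fits the degree budget
  have hjunta : 4 * w + 8 + 2 * J.card ≤ (Nat.log 2 n) ^ K := by
    have h1 : (Nat.log 2 n) ^ K = X * (Nat.log 2 n) ^ 4 := by rw [hK, hX, pow_add]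
    have h2 : 16 ≤ (Nat.log 2 n) ^ 4 := by
      calc (16 : ℕ) = 2 ^ 4 := by norm_num
        _ ≤ (Nat.log 2 n) ^ 4 := Nat.pow_le_pow_left (by omega) 4
    rw [h1]
    calc 4 * w + 8 + 2 * J.card ≤ 4 * X + 8 * X + 2 * X := by omega
      _ = X * 14 := by ring
      _ ≤ X * (Nat.log 2 n) ^ 4 := Nat.mul_le_mul_left _ (by omega)
  -- window sizes and room
  set L := (Nat.log 2 n) ^ (2 * K + 1) with hL
  have hwL : w ≤ L := hw'.trans (Nat.pow_le_pow_right (by omega) (by omega))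
  have hL4 : 4 ≤ L := le_trans (by norm_num) (le_trans hlog8 (by
    calc Nat.log 2 n = (Nat.log 2 n) ^ 1 := (pow_one _).symm
      _ ≤ L := Nat.pow_le_pow_right (by omega) (by omega)))
  set Hg := 2 * w + 4 with hHg
  set S := L + Hg + L with hSdef
  set T := (jreads J).card + 1 with hTdef
  have hT : T ≤ 2 * X + 1 := by have := card_jreads_le J; omega
  have hroom : T * S + 2 * w + 4 ≤ n := by
    have h1 := hn₂ n hn₂n
    have h3 : Nat.sqrt n ≤ n := Nat.sqrt_le_self n
    have hS5 : S ≤ 5 * L := by omega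
    have h64 : 64 ≤ (Nat.log 2 n) ^ 2 := by
      calc (64 : ℕ) = 8 ^ 2 := by norm_num
        _ ≤ (Nat.log 2 n) ^ 2 := Nat.pow_le_pow_left hlog8 2
    have hsplit : (Nat.log 2 n) ^ (2 * K + 2 * C + 3) = L * X * (Nat.log 2 n) ^ 2 := by
      rw [hL, hX, ← pow_add, ← pow_add]; congr 1; omega
    have hLX : L ≤ X * L := Nat.le_mul_of_pos_left L hX1
    calc T * S + 2 * w + 4 ≤ (2 * X + 1) * (5 * L) + 3 * L := by
          have := Nat.mul_le_mul hT hS5; omega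
      _ = 10 * (X * L) + 8 * L := by ring
      _ ≤ 10 * (X * L) + 8 * (X * L) := by omega
      _ = L * X * 18 := by ring
      _ ≤ L * X * (Nat.log 2 n) ^ 2 := Nat.mul_le_mul_left _ (by omega)
      _ = (Nat.log 2 n) ^ (2 * K + 2 * C + 3) := hsplit.symm
      _ ≤ n := h1.trans h3
  -- choose the window position by pigeonhole
  obtain ⟨t, htT, hfree⟩ := exists_free_slot (jreads J) (w + 2) S T (by omega) (by omega)
  set p := w + 2 + t * S with hp
  have htS : t * S + S ≤ T * S := by
    have : (t + 1) * S ≤ T * S := Nat.mul_le_mul_right _ htT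
    rw [add_mul, one_mul] at this; exact this
  have hfit : p + S + w + 2 ≤ n := by omega
  -- the transported strategy
  set y : Fin (n + 1) → (Fin n → Bool) → Bool := fun g u => xor (f (xOfU u) g) (tGuess (xOfU u) g) with hy
  have hdep : ∀ g (u v : Fin n → Bool), (∀ i ∈ reads w g ∪ jreads J, u i = v i) → y g u = y g v :=
    fun g u v huv => transported_congr_junta w J f hf g u v huv
  have hdeg : ∀ g, HasDeg (y g) ((Nat.log 2 n) ^ K) := by
    intro g
    unfold HasDeg
    refine lowDeg_mono ?_ (ind_mem_lowDeg_of_dependsOn (reads w g ∪ jreads J) (y g) (hdep g))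
    calc (reads w g ∪ jreads J).card ≤ (reads w g).card + (jreads J).card := card_union_le _ _
      _ ≤ (4 * w + 8) + 2 * J.card := add_le_add (card_reads_le w g) (card_jreads_le J)
      _ ≤ _ := hjunta
  have hcross1 : ∀ g : Fin (n + 1), p < g.val → g.val < p + L → ∀ u u' : Fin n → Bool,
      (∀ i : Fin n, ¬ (p + (L + Hg) ≤ i.val ∧ i.val < p + (L + Hg + L)) → u i = u' i) → y g u = y g u' := by
    intro g hg1 hg2 u u' huu'
    refine hdep g u u' fun i hi => huu' i ?_
    rcases mem_union.1 hi with hi | hi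
    · have := reads_subset_interval w g (by omega) (by omega) hi
      omega
    · have := hfree i hi
      omega
  have hcross3 : ∀ g : Fin (n + 1), p + (L + Hg) < g.val → g.val < p + (L + Hg + L) → ∀ u u' : Fin n → Bool,
      (∀ i : Fin n, ¬ (p ≤ i.val ∧ i.val < p + L) → u i = u' i) → y g u = y g u' := by
    intro g hg1 hg2 u u' huu'
    refine hdep g u u' fun i hi => huu' i ?_
    rcases mem_union.1 hi with hi | hi
    · have := reads_subset_interval w g (by omega) (by omega) hi
      omega
    · have := hfree i hi
      omega
  have hwin := hn₁ n hn₁n p L Hg L (by omega) le_rfl le_rfl (n + 2) y hdeg hcross1 hcross3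
  have hinj : ∀ Sx : Finset (Fin (n + 1) → Bool), (∀ x ∈ Sx, OddZeros x ∧ RingHLF.Rel x (f x)) →
      Sx.card ≤ (univ.filter fun u : Fin n → Bool => ringWinU (n + 2) y u = true).card := by
    intro Sx hSx
    refine card_le_card_of_injOn uVec (fun x hx => ?_) (fun x₁ hx₁ x₂ hx₂ h => ?_)
    · have hx' := hSx x (mem_coe.1 hx)
      rw [mem_coe, mem_filter]
      exact ⟨mem_univ _, (rel_iff_ringWinU (by omega) x hx'.1 f).1 hx'.2⟩
    · have h₁ := hSx x₁ (mem_coe.1 hx₁)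
      have h₂ := hSx x₂ (mem_coe.1 hx₂)
      rw [← xOfU_uVec (by omega) x₁ h₁.1, ← xOfU_uVec (by omega) x₂ h₂.1, h]
  rw [Nat.add_sub_cancel]
  refine le_trans ?_ hwin
  refine (Nat.cast_le (α := ℝ)).2 (hinj _ fun x hx => ?_)
  simp only [mem_filter, mem_univ, true_and] at hx
  exact hx

end Summit.QuantumAdvantage.AdviceFreeQNC0

end
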